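import Summits.HodgeConjecture.CorCM.ImaginaryQuadraticsTimesConjSquareCMHodge
import Literature.NumberTheory.ComplexMultiplication.CMTypeRankPartialConjugation
import Literature.NumberTheory.ComplexMultiplication.PartialConjugationOfRealIntersection
import HarnessLib

/-!
# `E_1^{a_1} × ⋯ × E_r^{a_r} × A_1^{b_1} × ⋯ × A_m^{b_m}`: pairwise non-isogenous CM elliptic curves times SEVERAL CM abelian
# varieties admitting partial conjugations — the block mechanism composed with slot-by-slot partial conjugations

COR-CM (cell `pub-hodgecm2`, seat p2 gen 17, count-neutral claim MULTIQUAD-BLOCK (F3)); NEW as stated, hence under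
`Summits/`.  Theorems only; no definition, no named fact, no `sorry`.

Sequel of `ImaginaryQuadraticsTimesConjSquareCMHodge` (F2: ONE non-quadratic slot `i₁`, block `{i₁}`, block partial
conjugation `τ²` from (□)).  Here the block `B = {i | p i}` of non-quadratic slots is ARBITRARY, and the input is a
PARTIAL CONJUGATION AT EVERY SLOT OF `B` in the sense of `CMTypeRankPartialConjugation` (seat b23): some `σ_b ∈ Aut(ℂ)`
that is complex conjugation on `Hom(K_b, ℂ)` and the identity on `Hom(K_j, ℂ)` for ALL `j ≠ b` (quadratic or not) —
supplied at the level of fields by `PartialConjugationOfRealIntersection.exists_partialConj_of_conj_apply_eq` (seat b23: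
the Galois closure of `K_b` meets the compositum of the other Galois closures in a totally real field).  NOTHING is asked
of the quadratic slots `j ∉ B` (no partial conjugation need exist there: `ℚ(√-1), ℚ(√-2), ℚ(√-3), ℚ(√-6)`).

* §1 (abstract, `G` acting slot by slot on `⊔_i E_i`, namespace `BlockConj`): **`exists_blockConj`** — the PRODUCT of the
  `σ_b`, `b ∈ B` (in any order; `Finset` induction, no commutation needed) is a block partial conjugation for `B`
  (`ρ` on every `E_b`, `b ∈ B`, trivial off `B`); **`typeRank_sigmaType_eq_iff_of_forall_partialConj`** — `Σ` is
  nondegenerate iff every `Φ_b`, `b ∈ B`, is nondegenerate AND the sub-family `Σ|_{Bᶜ}` is nondegenerate (F1's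
  `typeRank_sigmaType_eq_iff_of_block` for the product, then b23's `typeRank_sigmaType_eq_iff_forall_of_partialConj`
  INSIDE the block, where the `σ_b` restrict to partial conjugations of the sub-family `Σ|_B`).
* §2 (CM fields): **`isNondegenerateFamily_iff_of_forall_partialConj`** — for `[K_j : ℚ] = 2` off `B` and partial
  conjugations on `B` (both parts nonempty): `(Φ_i)_i` nondegenerate ⟺ (∀ `b ∈ B`, `Φ_b` nondegenerate) ∧ the quadratic
  sub-family `(Φ_j)_{j∉B}` is separating (`QuadraticCMFamiliesHodge`, seat lit-deligne-3); sufficiency without the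
  nonemptiness side conditions on `B` (`isNondegenerateFamily_of_forall_partialConj`; `Bᶜ = ∅` is b23's setting and is
  not restated — the quadratic part is asked to be nonempty only through `IsSeparatingFamily` being about it).
* §3 geometry: `hodgeClassSpan_prod_eq_divisorClassesSpan_of_forall_partialConj`, `not_exists_exceptional_prod_…`,
  **`hodgeConjectureFor_prod_of_forall_partialConj`**; and the field-level instance
  **`hodgeConjectureFor_prod_of_quadratics_of_realIntersection_of_isSimple`**: the Hodge conjecture for every
  `E_1^{a_1} × ⋯ × E_r^{a_r} × S_1^{c_1} × ⋯ × S_m^{c_m}` with `E_j` pairwise non-isogenous CM elliptic curves (separating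
  quadratic family) and `S_b` SIMPLE CM abelian surfaces whose quartic CM fields `K_b` satisfy: complex conjugation fixes
  `L_b ∩ (compositum of the Galois closures of all the other fields)` pointwise — unconditionally, no named fact.
  (For ONE surface no condition at all is needed: F2.  The real-intersection condition is SUFFICIENT for the existence
  of partial conjugations — sharp for them by b23's `exists_partialConj_iff_conj_apply_eq` — but not necessary for
  nondegeneracy: a simple CM surface with non-Galois quartic field and its reflex surface share their Galois closure, so
  no partial conjugation exists, yet Deligne's rank of the pair is still maximal.)

Sources: [Gordon1999HodgeAVSurvey] §3 (Imai–Murty, proof: "there is some `σ ∈ 𝒢` that acts as `+1` on `X(K^×_{1,1})`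
and `−1` on the other components … by induction the kernel of `λ` is zero"), 7.5, 10.10; [Deligne1982HodgeCycles] I
Ex. 3.7 (c); [MoonenZarhin1999LowDim] Cor. (3.9); [Shimura1998] §8.2 Prop. 26, §8.4 (2).
-/

noncomputable section

open CategoryTheory CategoryTheory.Limits NumberField NumberField.ComplexEmbedding IntermediateField
open scoped BigOperators

/-! ## §1 Abstract: the product of slot partial conjugations is a block partial conjugation -/

namespace Summit.HodgeConjecture.CorCM.BlockConj

open Literature.NumberTheory.ComplexMultiplication

variable {G : Type*} [Group G] {I : Type*} {E : I → Type*} [∀ i, MulAction G (E i)]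

/-- The product (in any order) of partial conjugations at the slots of a finite set `S` acts as `ρ` on every slot of `S`
and trivially off `S` ("`σm + m = (2m_1, 0, …, 0)` … by induction"). [cite: Gordon1999HodgeAVSurvey, §3 Theorem (proof)] -/
theorem exists_blockConj_finset [DecidableEq I] {ρ : G} (S : Finset I)
    (hconj : ∀ i ∈ S, ∃ σ : G, (∀ s : E i, σ • s = ρ • s) ∧ ∀ j, j ≠ i → ∀ s : E j, σ • s = s) :
    ∃ σ : G, (∀ i ∈ S, ∀ s : E i, σ • s = ρ • s) ∧ ∀ i, i ∉ S → ∀ s : E i, σ • s = s := by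
  induction S using Finset.induction_on with
  | empty => exact ⟨1, fun i hi => absurd hi (Finset.notMem_empty i), fun i _ s => one_smul G s⟩
  | @insert b S hb ih =>
    obtain ⟨σ, hσ, hσ'⟩ := ih fun i hi => hconj i (Finset.mem_insert_of_mem hi)
    obtain ⟨τ, hτ, hτ'⟩ := hconj b (Finset.mem_insert_self b S)
    refine ⟨τ * σ, fun i hi s => ?_, fun i hi s => ?_⟩
    · rw [mul_smul]
      rcases Finset.mem_insert.1 hi with rfl | hi'
      · rw [hσ' _ hb s]
        exact hτ s
      · have hib : i ≠ b := fun hh => hb (hh ▸ hi')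
        rw [hσ i hi' s]
        exact hτ' i hib (ρ • s)
    · rw [mul_smul]
      have hib : i ≠ b := fun hh => hi (hh ▸ Finset.mem_insert_self b S)
      have hiS : i ∉ S := fun hh => hi (Finset.mem_insert_of_mem hh)
      rw [hσ' i hiS s]
      exact hτ' i hib s

/-- **Partial conjugations at every slot of a block `B = {i | p i}` give a block partial conjugation for `B`** (their
product): `ρ` on every `E_b`, `b ∈ B`, the identity on every `E_j`, `j ∉ B`. [cite: Gordon1999HodgeAVSurvey, §3 Theorem (proof)] -/
theorem exists_blockConj [Fintype I] [DecidableEq I] (p : I → Prop) [DecidablePred p] {ρ : G}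
    (hconj : ∀ i, p i → ∃ σ : G, (∀ s : E i, σ • s = ρ • s) ∧ ∀ j, j ≠ i → ∀ s : E j, σ • s = s) :
    ∃ σ : G, (∀ i, p i → ∀ s : E i, σ • s = ρ • s) ∧ ∀ i, ¬p i → ∀ s : E i, σ • s = s := by
  obtain ⟨σ, h1, h2⟩ := exists_blockConj_finset (E := E) (Finset.univ.filter p)
    fun i hi => hconj i (Finset.mem_filter.1 hi).2
  exact ⟨σ, fun i hi => h1 i (Finset.mem_filter.2 ⟨Finset.mem_univ i, hi⟩),
    fun i hi => h2 i fun hh => hi (Finset.mem_filter.1 hh).2⟩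

/-- The partial conjugations at the slots of `B` restrict to partial conjugations of the sub-family `Σ|_B` at every slot.
[cite: Gordon1999HodgeAVSurvey, §3 Theorem (proof)] -/
theorem forall_exists_partialConj_subtype (p : I → Prop) {ρ : G}
    (hconj : ∀ i, p i → ∃ σ : G, (∀ s : E i, σ • s = ρ • s) ∧ ∀ j, j ≠ i → ∀ s : E j, σ • s = s) :
    ∀ i : {i // p i}, ∃ σ : G, (∀ s : E i.1, σ • s = ρ • s) ∧
      ∀ j : {i // p i}, j ≠ i → ∀ s : E j.1, σ • s = s := fun i => by
  obtain ⟨τ, hτ, hτ'⟩ := hconj i.1 i.2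
  exact ⟨τ, hτ, fun j hj => hτ' j.1 fun hh => hj (Subtype.ext hh)⟩

/-- **Nondegeneracy with partial conjugations on a block**: if a partial conjugation exists at every slot of
`B = {i | p i}` (relative to ALL slots), then `Σ` is nondegenerate iff every `Φ_b`, `b ∈ B`, is nondegenerate and the
sub-family `Σ|_{Bᶜ}` is nondegenerate — the block splitting (`typeRank_sigmaType_eq_iff_of_block`) for the product of the
`σ_b`, then rank additivity inside the block (`typeRank_sigmaType_eq_iff_forall_of_partialConj`).  Nothing is asked of
the slots off `B`. [cite: Gordon1999HodgeAVSurvey, §3 Theorem and 7.5] -/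
theorem typeRank_sigmaType_eq_iff_of_forall_partialConj [Fintype I] [DecidableEq I] [∀ i, Fintype (E i)]
    [∀ i, Nonempty (E i)] (p : I → Prop) [DecidablePred p] {ρ : G} {Φ : ∀ i, Set (E i)}
    (h : ∀ i, IsCMTypeWith ρ (Φ i))
    (hconj : ∀ i, p i → ∃ σ : G, (∀ s : E i, σ • s = ρ • s) ∧ ∀ j, j ≠ i → ∀ s : E j, σ • s = s)
    (hp : ∃ i, p i) (hnp : ∃ i, ¬p i) :
    typeRank G (sigmaType Φ) = Fintype.card (Σ i, E i) / 2 + 1 ↔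
      (∀ i, p i → typeRank G (Φ i) = Fintype.card (E i) / 2 + 1) ∧
        typeRank G (sigmaType fun i : {i // ¬p i} => Φ i.1) = Fintype.card (Σ i : {i // ¬p i}, E i.1) / 2 + 1 := by
  obtain ⟨σ, hσ, hσ'⟩ := exists_blockConj (E := E) p hconj
  rw [typeRank_sigmaType_eq_iff_of_block p h hσ hσ' hp hnp]
  refine and_congr ?_ Iff.rfl
  obtain ⟨i₀, hi₀⟩ := hp
  haveI : Nonempty {i // p i} := ⟨⟨i₀, hi₀⟩⟩
  rw [typeRank_sigmaType_eq_iff_forall_of_partialConj (G := G) (Φ := fun i : {i // p i} => Φ i.1) (fun i => h i.1)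
    (forall_exists_partialConj_subtype (E := E) p hconj)]
  exact ⟨fun H i hi => H ⟨i, hi⟩, fun H i => H i.1 i.2⟩

end Summit.HodgeConjecture.CorCM.BlockConj

/-! ## §2 CM fields: a block of partially conjugable fields and imaginary quadratic partners -/

namespace Summit.HodgeConjecture.CorCM

open Literature.NumberTheory.ComplexMultiplication
open Literature.AlgebraicGeometry.Motives (AbelianVariety CMType)
open Literature.AlgebraicGeometry.HodgeTheory
open Literature.AlgebraicGeometry.ComplexMultiplication (IsCMTypeRealisation isSimple_iff_isPrimitive)
open Literature.AlgebraicGeometry.VanGeemen1994 (hodgeClassSpan)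
open Literature.AlgebraicGeometry.Pohlmann1968
open Literature.Barriers.HodgeConjecture (divisorClassesSpan)

section Fields

variable {I : Type} {K : I → Type} [∀ i, Field (K i)] [∀ i, NumberField (K i)] [∀ i, IsCMField (K i)] [Fintype I]
  [DecidableEq I]

omit [∀ i, IsCMField (K i)] [DecidableEq I] in
/-- `|⊔_i Hom(K_i, ℂ)| = Σ_i [K_i : ℚ]`. [folklore] -/
private theorem card_sigma_ringHom_eq_sum' :
    Fintype.card ((i : I) × (K i →+* ℂ)) = ∑ i, Module.finrank ℚ (K i) := by
  rw [Fintype.card_sigma]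
  exact Finset.sum_congr rfl fun i _ => Embeddings.card (K i) ℂ

/-- **Nondegeneracy criterion: a block `B` of partially conjugable CM fields and imaginary quadratic partners.**  If
`[K_j : ℚ] = 2` for `j ∉ B` and every `b ∈ B` carries a partial conjugation `σ_b ∈ Aut(ℂ)` (complex conjugation on
`Hom(K_b, ℂ)`, the identity on every other `Hom(K_j, ℂ)`), both parts nonempty, then `(Φ_i)_i` is nondegenerate iff every
`Φ_b`, `b ∈ B`, is nondegenerate AND the quadratic sub-family `(Φ_j)_{j∉B}` is separating (pairwise non-isogenous CM
elliptic curves).  No condition among the quadratic fields. [cite: Gordon1999HodgeAVSurvey, §3 Theorem and 7.5]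
[cite: MoonenZarhin1999LowDim, Cor. (3.9)] -/
theorem isNondegenerateFamily_iff_of_forall_partialConj (p : I → Prop) [DecidablePred p]
    (h2 : ∀ j, ¬p j → Module.finrank ℚ (K j) = 2)
    (hconj : ∀ b, p b → ∃ σ : ℂ ≃+* ℂ, (∀ s : K b →+* ℂ, σ • s = (starRingAut : ℂ ≃+* ℂ) • s) ∧
      ∀ j, j ≠ b → ∀ s : K j →+* ℂ, σ • s = s)
    (hp : ∃ b, p b) (hnp : ∃ j, ¬p j) (Φ : ∀ i, CMType (K i)) :
    CMAlgebra.IsNondegenerateFamily Φ ↔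
      (∀ b, p b → IsNondegenerate (Φ b)) ∧ CMAlgebra.IsSeparatingFamily (fun j : {j // ¬p j} => Φ j.1) := by
  have key := BlockConj.typeRank_sigmaType_eq_iff_of_forall_partialConj (G := ℂ ≃+* ℂ) (Φ := fun i => (Φ i).1) p
    (fun i => isCMTypeWith_conj (Φ i)) hconj hp hnp
  obtain ⟨j₀, hj₀⟩ := hnp
  haveI : Nonempty {j // ¬p j} := ⟨⟨j₀, hj₀⟩⟩
  rw [CMAlgebra.isNondegenerateFamily_iff, ← card_sigma_ringHom_eq_sum' (K := K)]
  refine key.trans (and_congr ⟨fun H b hb => ?_, fun H b hb => ?_⟩ ?_)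
  · rw [isNondegenerate_iff, cmTypeRank, ← Embeddings.card (K b) ℂ]
    exact H b hb
  · have := H b hb
    rw [isNondegenerate_iff, cmTypeRank, ← Embeddings.card (K b) ℂ] at this
    exact this
  · rw [← isNondegenerateFamily_iff_isSeparatingFamily_of_finrank_eq_two (fun j : {j // ¬p j} => h2 j.1 j.2),
      CMAlgebra.isNondegenerateFamily_iff, ← card_sigma_ringHom_eq_sum' (K := fun j : {j // ¬p j} => K j.1)]
    exact Iff.rfl

/-- **Sufficiency** (no nonemptiness condition on the block): every `Φ_b`, `b ∈ B`, nondegenerate and the quadratic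
sub-family separating ⟹ `(Φ_i)_i` nondegenerate — `∏_{b∈B} A_b^{k_b} × ∏_j E_j^{k_j}` is stably nondegenerate.
[cite: Gordon1999HodgeAVSurvey, §3 Theorem and 7.5] [cite: MoonenZarhin1999LowDim, Cor. (3.9)] -/
theorem isNondegenerateFamily_of_forall_partialConj (p : I → Prop) [DecidablePred p]
    (h2 : ∀ j, ¬p j → Module.finrank ℚ (K j) = 2)
    (hconj : ∀ b, p b → ∃ σ : ℂ ≃+* ℂ, (∀ s : K b →+* ℂ, σ • s = (starRingAut : ℂ ≃+* ℂ) • s) ∧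
      ∀ j, j ≠ b → ∀ s : K j →+* ℂ, σ • s = s)
    (hnp : ∃ j, ¬p j) {Φ : ∀ i, CMType (K i)} (hΦ : ∀ b, p b → IsNondegenerate (Φ b))
    (hsep : CMAlgebra.IsSeparatingFamily (fun j : {j // ¬p j} => Φ j.1)) :
    CMAlgebra.IsNondegenerateFamily Φ := by
  by_cases hp : ∃ b, p b
  · exact (isNondegenerateFamily_iff_of_forall_partialConj p h2 hconj hp hnp Φ).2 ⟨hΦ, hsep⟩
  · -- no block: every slot is imaginary quadratic, and the whole family is the quadratic sub-family
    have hall : ∀ j, ¬p j := fun j hj => hp ⟨j, hj⟩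
    obtain ⟨j₀, hj₀⟩ := hnp
    haveI : Nonempty I := ⟨j₀⟩
    refine isNondegenerateFamily_of_finrank_eq_two (fun j => h2 j (hall j)) ?_
    rw [CMAlgebra.isSeparatingFamily_iff_smul] at hsep ⊢
    rintro ⟨i, s⟩ ⟨i', s'⟩ H
    have := hsep ⟨⟨i, hall i⟩, s⟩ ⟨⟨i', hall i'⟩, s'⟩ fun τ => by
      rw [CMAlgebra.smul_mem_familyType_iff, CMAlgebra.smul_mem_familyType_iff]
      have h1 := H τ
      rw [CMAlgebra.smul_mem_familyType_iff, CMAlgebra.smul_mem_familyType_iff] at h1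
      exact h1
    obtain ⟨h₁, h₂⟩ := Sigma.mk.inj this
    have hi : i = i' := congrArg Subtype.val h₁
    subst hi
    cases h₁
    exact congrArg (Sigma.mk i) (eq_of_heq h₂)

end Fields

/-! ## §3 Geometry: `B• = D•` and the Hodge conjecture on every `∏_j E_j^{a_j} × ∏_{b∈B} A_b^{c_b}` -/

section Geometry

variable {I : Type} {K : I → Type} [∀ i, Field (K i)] [∀ i, NumberField (K i)] [∀ i, IsCMField (K i)] [Fintype I]
  [DecidableEq I] [Nonempty I] {Φ : ∀ i, CMType (K i)}
variable {A : I → AbelianVariety ℂ} {ι : ∀ i, 𝓞 (K i) →+* End (A i)}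
  {θ : ∀ i, K i →+* Module.End ℂ (complexBetti (A i).X 1)}

/-- **`Bᵐ ⊗ ℂ = Dᵐ ⊗ ℂ` on every `∏_j E_j^{a_j} × ∏_{b∈B} A_b^{c_b}`** (every `⨁_{k<N} A_{π k}`): partial conjugations on the block
`B`, nondegenerate `Φ_b` (`b ∈ B`), separating quadratic partners. [cite: Gordon1999HodgeAVSurvey, §3 Theorem (2) and 7.5] -/
theorem hodgeClassSpan_prod_eq_divisorClassesSpan_of_forall_partialConj (p : I → Prop) [DecidablePred p]
    (h2 : ∀ j, ¬p j → Module.finrank ℚ (K j) = 2)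
    (hconj : ∀ b, p b → ∃ σ : ℂ ≃+* ℂ, (∀ s : K b →+* ℂ, σ • s = (starRingAut : ℂ ≃+* ℂ) • s) ∧
      ∀ j, j ≠ b → ∀ s : K j →+* ℂ, σ • s = s)
    (hnp : ∃ j, ¬p j) (hΦ : ∀ b, p b → IsNondegenerate (Φ b))
    (hsep : CMAlgebra.IsSeparatingFamily (fun j : {j // ¬p j} => Φ j.1))
    (hA : ∀ i, IsCMTypeRealisation (Φ i) (A i) (ι i) (θ i)) {N : ℕ} (π : Fin N → I) (m : ℕ) :
    hodgeClassSpan (⨁ fun j : Fin N => A (π j)).dim (⨁ fun j : Fin N => A (π j)).X m =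
      divisorClassesSpan (⨁ fun j : Fin N => A (π j)).X (⨁ fun j : Fin N => A (π j)).dim m :=
  (isNondegenerateFamily_of_forall_partialConj p h2 hconj hnp hΦ hsep).hodgeClassSpan_prod_eq_divisorClassesSpan hA π m

/-- **No `∏_j E_j^{a_j} × ∏_{b∈B} A_b^{c_b}` as above supports an exotic Hodge class.**
[cite: Gordon1999HodgeAVSurvey, §3 Theorem (2) and 7.5] -/
theorem not_exists_exceptional_prod_of_forall_partialConj (p : I → Prop) [DecidablePred p]
    (h2 : ∀ j, ¬p j → Module.finrank ℚ (K j) = 2)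
    (hconj : ∀ b, p b → ∃ σ : ℂ ≃+* ℂ, (∀ s : K b →+* ℂ, σ • s = (starRingAut : ℂ ≃+* ℂ) • s) ∧
      ∀ j, j ≠ b → ∀ s : K j →+* ℂ, σ • s = s)
    (hnp : ∃ j, ¬p j) (hΦ : ∀ b, p b → IsNondegenerate (Φ b))
    (hsep : CMAlgebra.IsSeparatingFamily (fun j : {j // ¬p j} => Φ j.1))
    (hA : ∀ i, IsCMTypeRealisation (Φ i) (A i) (ι i) (θ i)) {N : ℕ} (π : Fin N → I) (m : ℕ) :
    ¬∃ c : complexBetti (⨁ fun j : Fin N => A (π j)).X (2 * m), IsRationalClass c ∧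
        IsOfHodgeType (⨁ fun j : Fin N => A (π j)).dim (⨁ fun j : Fin N => A (π j)).X (2 * m) m m c ∧
        c ∉ divisorClassesSpan (⨁ fun j : Fin N => A (π j)).X (⨁ fun j : Fin N => A (π j)).dim m :=
  (isNondegenerateFamily_of_forall_partialConj p h2 hconj hnp hΦ hsep).not_exists_exceptional_prod hA π m

/-- **The Hodge conjecture for every `E_1^{a_1} × ⋯ × E_r^{a_r} × A_1^{c_1} × ⋯ × A_m^{c_m}`** — every `⨁_{k<N} A_{π k}`
for a family whose non-quadratic slots `b ∈ B` carry partial conjugations and realise NONDEGENERATE CM types, and whose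
quadratic slots are a SEPARATING family of CM elliptic curves — UNCONDITIONAL, no named fact.
[cite: Gordon1999HodgeAVSurvey, §3 Theorem and 10.10] [cite: MoonenZarhin1999LowDim, Cor. (3.9)] -/
theorem hodgeConjectureFor_prod_of_forall_partialConj (p : I → Prop) [DecidablePred p]
    (h2 : ∀ j, ¬p j → Module.finrank ℚ (K j) = 2)
    (hconj : ∀ b, p b → ∃ σ : ℂ ≃+* ℂ, (∀ s : K b →+* ℂ, σ • s = (starRingAut : ℂ ≃+* ℂ) • s) ∧
      ∀ j, j ≠ b → ∀ s : K j →+* ℂ, σ • s = s)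
    (hnp : ∃ j, ¬p j) (hΦ : ∀ b, p b → IsNondegenerate (Φ b))
    (hsep : CMAlgebra.IsSeparatingFamily (fun j : {j // ¬p j} => Φ j.1))
    (hA : ∀ i, IsCMTypeRealisation (Φ i) (A i) (ι i) (θ i)) {N : ℕ} (π : Fin N → I) :
    HodgeConjectureFor (⨁ fun j : Fin N => A (π j)).dim (⨁ fun j : Fin N => A (π j)).X :=
  (isNondegenerateFamily_of_forall_partialConj p h2 hconj hnp hΦ hsep).hodgeConjectureFor_prod hA π

/-- **Field-level instance: several SIMPLE CM abelian surfaces and pairwise non-isogenous CM elliptic curves.**  The Hodge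
conjecture holds on every `E_1^{a_1} × ⋯ × E_r^{a_r} × S_1^{c_1} × ⋯ × S_m^{c_m}` (every `⨁_{k<N} A_{π k}`) provided: the
`S_b = A_b` (`b ∈ B`) are SIMPLE with quartic CM fields `K_b` such that complex conjugation fixes pointwise the
intersection of the Galois closure `L_b` of `K_b` with the compositum of the Galois closures of ALL the other fields
(b23's real-intersection criterion, `exists_partialConj_of_conj_apply_eq`), and the `E_j = A_j` (`j ∉ B`, `[K_j:ℚ] = 2`,
at least one) form a separating family — UNCONDITIONAL.  (For a single surface no condition is needed:
`hodgeConjectureFor_prod_of_quadratics_of_isSimple`; the condition here is sufficient, not necessary.)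
[cite: Gordon1999HodgeAVSurvey, §3 Theorem and 10.10]
[cite: Shimura1998, §8.2 Prop. 26 and §8.4 (2)] -/
theorem hodgeConjectureFor_prod_of_quadratics_of_realIntersection_of_isSimple (p : I → Prop) [DecidablePred p]
    (h2 : ∀ j, ¬p j → Module.finrank ℚ (K j) = 2) (h4 : ∀ b, p b → Module.finrank ℚ (K b) = 4)
    (hreal : ∀ b, p b → ∀ x : ℂ, x ∈ normalClosure ℚ (K b) ℂ →
      x ∈ (⨆ j : {j : I // j ≠ b}, normalClosure ℚ (K j.1) ℂ) → starRingEnd ℂ x = x)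
    (hnp : ∃ j, ¬p j) (hsep : CMAlgebra.IsSeparatingFamily (fun j : {j // ¬p j} => Φ j.1))
    (hA : ∀ i, IsCMTypeRealisation (Φ i) (A i) (ι i) (θ i)) (hS : ∀ b, p b → (A b).IsSimple) {N : ℕ}
    (π : Fin N → I) : HodgeConjectureFor (⨁ fun j : Fin N => A (π j)).dim (⨁ fun j : Fin N => A (π j)).X := by
  refine hodgeConjectureFor_prod_of_forall_partialConj p h2 (fun b hb => exists_partialConj_of_conj_apply_eq b (hreal b hb))
    hnp (fun b hb => ?_) hsep hA π
  obtain ⟨φ₀⟩ : Nonempty (K b →+* ℂ) := inferInstance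
  exact QuarticCM.isNondegenerate_of_isPrimitive (h4 b hb) _ ((isSimple_iff_isPrimitive (hA b) φ₀).1 (hS b hb))

end Geometry

end Summit.HodgeConjecture.CorCM

end
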